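import Mathlib
import Summits.ValiantsHypothesis.ValiantsHypothesis.Theorems.RigidityForcesSymmetryRankRigidMinimalReprLaplaceDefs

/-!
# `LaplaceOptimal 4` is BORDER-FALSE: the permutation pattern of order 4 is a first-order Plücker degeneration
# of FIVE split-rank-one terms (Laplace weight 20 < 24)
# (crux `RankRigidMinimalRepr`, stmt-ValiantsHypothesis-18034, route `RigidityForcesSymmetry` — negative-side calibration)

The level-count ENGINE of the line `PairTiedTorusBound` (`…LevelBoundOfLaplace.lean`: `LaplaceOptimal (k+1) →` the sharp
count `C(m,s) ≤ w` for `k+1` tied columns; with the dictionary `stub_levelDecomp` now landed, `…TiedTorusBoundOneTwo.lean`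
turns every theorem `LaplaceOptimal d` into a rung) needs, for FOUR tied columns, the finite statement `LaplaceOptimal 4`:
every expression of the pattern `P₄(v) = [v : [4] → [4] injective]` as a sum of split-rank-one terms `u_t(v|_{S_t}) w_t(v|_{S_tᶜ})`
has `Σ_t |S_t|! (4 - |S_t|)! ≥ 4! = 24`.  p8 g7's numerics (kit j282380 … j286269, evidence on the item) found that `P₄` lies
in the CLOSURE of the weight-20 families through a three-way collision of the row splits at a Grassmann–Plücker point.
This file gives that degeneration in CLOSED FORM with `0/±1` entries and certifies it in the kernel.

Letters `{0,2}` and `{1,3}`; on pairs of letters put `A = e₀₂ - e₂₀`, `N = e₀₂ + e₂₀`, `K = e₁₃ + e₃₁`; write `X_{ij}` for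
`X(v_i, v_j)`.  Then, identically in `ε` (three coefficient identities over `ℤ`, `decide`):

  `ε·P₄ + ε²·E = -A₀₁A₂₃ - (N₀₂ - εK₀₂)(N₁₃ - εK₁₃) + (N₀₃ + εK₀₃)(N₁₂ + εK₁₂) + ε·K₀₁N₂₃ + ε·N₀₁K₂₃`,  `E = -K₀₂K₁₃ + K₀₃K₁₂`:

* `ε⁰`: `-A₀₁A₂₃ - N₀₂N₁₃ + N₀₃N₁₂ = 0` — the three-term Grassmann–Plücker relation (`plucker_coeff_zero`);
* `ε¹`: `P₄ = Σ_{|S|=2} N_S ⊗ K_{Sᶜ}` — the slots holding `{0,2}` and those holding `{1,3}` (`laplace_coeff_one`);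
* `ε²`: the definition of `E`.

Dividing by `ε ≠ 0`: `P₄ + ε·E` is the sum of the FIVE split-rank-one terms `-ε⁻¹A₀₁ ⊗ A₂₃`, `-ε⁻¹(N-εK)₀₂ ⊗ (N-εK)₁₃`,
`ε⁻¹(N+εK)₀₃ ⊗ (N+εK)₁₂`, `K₀₁ ⊗ N₂₃`, `N₀₁ ⊗ K₂₃`, all across splits of size `2` (weight `2!·2! = 4` each, total `20 < 24`), and
`P₄ + εE → P₄`.  `laplaceOptimal_four_border` states exactly this in the data format of `LaplaceOptimal 4`: for every `ε ≠ 0`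
the inequality of `LaplaceOptimal 4` FAILS for the perturbed pattern `P₄ + εE` ("border row-pair Laplace cost of `perm₄` is
`5 < 6`").  CONSEQUENCE for the ladder: the EXACT statement `LaplaceOptimal 4` (open) cannot be proved by any invariant that is
Zariski-closed in the terms (flattening ranks, slice/partition-rank bounds — the tools that prove orders `2` and `3`); it needs a
non-closed invariant.

HONEST FRAMING: a negative-side CALIBRATION of one rung's engine inside one route.  It does NOT refute `LaplaceOptimal 4`, the
landed stubs `stub_levelDecomp` / `stub_levelBound`, or the crux `RankRigidMinimalRepr` (all untouched; the crux stays OPEN and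
target-calibrated); census-neutral; `VP ≠ VNP` is NOT proved and nothing here bears on it.
-/

set_option autoImplicit false

-- the mandated summit-side namespace repeats a component by design (single-problem summit)
set_option linter.dupNamespace false

namespace Summit.ValiantsHypothesis.ValiantsHypothesis.Theorems.RigidityForcesSymmetryRankRigidMinimalRepr

namespace LaplaceFourBorder

/-- The `ε⁰` coefficient: the three-term Grassmann–Plücker relation `-A₀₁A₂₃ - N₀₂N₁₃ + N₀₃N₁₂ = 0` for `A = e₀₂ - e₂₀`,
`N = e₀₂ + e₂₀` (checked on all `4⁴` assignments). -/
theorem plucker_coeff_zero : ∀ a b c d : Fin 4,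
    -((if a = 0 ∧ b = 2 then (1 : ℤ) else if a = 2 ∧ b = 0 then -1 else 0) *
        (if c = 0 ∧ d = 2 then (1 : ℤ) else if c = 2 ∧ d = 0 then -1 else 0))
      - (if (a = 0 ∧ c = 2) ∨ (a = 2 ∧ c = 0) then (1 : ℤ) else 0) *
          (if (b = 0 ∧ d = 2) ∨ (b = 2 ∧ d = 0) then (1 : ℤ) else 0)
      + (if (a = 0 ∧ d = 2) ∨ (a = 2 ∧ d = 0) then (1 : ℤ) else 0) *
          (if (b = 0 ∧ c = 2) ∨ (b = 2 ∧ c = 0) then (1 : ℤ) else 0) = 0 := by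
  decide

/-- The `ε¹` coefficient: the permutation pattern of order `4` is `Σ_{|S| = 2} N_S ⊗ K_{Sᶜ}` (`N = e₀₂ + e₂₀` on the two slots
`S` holding the letters `0, 2`, `K = e₁₃ + e₃₁` on the two slots holding `1, 3`; six slot-pairs `S`), written with the pattern
as the pairwise-distinctness indicator. -/
theorem laplace_coeff_one : ∀ a b c d : Fin 4,
    (if (a = 0 ∧ c = 2) ∨ (a = 2 ∧ c = 0) then (1 : ℤ) else 0) * (if (b = 1 ∧ d = 3) ∨ (b = 3 ∧ d = 1) then (1 : ℤ) else 0)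
      + (if (a = 1 ∧ c = 3) ∨ (a = 3 ∧ c = 1) then (1 : ℤ) else 0) *
          (if (b = 0 ∧ d = 2) ∨ (b = 2 ∧ d = 0) then (1 : ℤ) else 0)
      + (if (a = 0 ∧ d = 2) ∨ (a = 2 ∧ d = 0) then (1 : ℤ) else 0) *
          (if (b = 1 ∧ c = 3) ∨ (b = 3 ∧ c = 1) then (1 : ℤ) else 0)
      + (if (a = 1 ∧ d = 3) ∨ (a = 3 ∧ d = 1) then (1 : ℤ) else 0) *
          (if (b = 0 ∧ c = 2) ∨ (b = 2 ∧ c = 0) then (1 : ℤ) else 0)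
      + (if (a = 1 ∧ b = 3) ∨ (a = 3 ∧ b = 1) then (1 : ℤ) else 0) *
          (if (c = 0 ∧ d = 2) ∨ (c = 2 ∧ d = 0) then (1 : ℤ) else 0)
      + (if (a = 0 ∧ b = 2) ∨ (a = 2 ∧ b = 0) then (1 : ℤ) else 0) *
          (if (c = 1 ∧ d = 3) ∨ (c = 3 ∧ d = 1) then (1 : ℤ) else 0)
      = if (a ≠ b ∧ a ≠ c ∧ a ≠ d ∧ b ≠ c ∧ b ≠ d ∧ c ≠ d) then 1 else 0 := by
  decide

/-- A map `v : Fin 4 → Fin 4` is injective iff its four values are pairwise distinct. -/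
theorem injective_iff_pairwise (v : Fin 4 → Fin 4) :
    Function.Injective v ↔ (v 0 ≠ v 1 ∧ v 0 ≠ v 2 ∧ v 0 ≠ v 3 ∧ v 1 ≠ v 2 ∧ v 1 ≠ v 3 ∧ v 2 ≠ v 3) := by
  constructor
  · intro h
    refine ⟨fun e => ?_, fun e => ?_, fun e => ?_, fun e => ?_, fun e => ?_, fun e => ?_⟩ <;>
      exact absurd (h e) (by decide)
  · rintro ⟨h01, h02, h03, h12, h13, h23⟩ i j hij
    fin_cases i <;> fin_cases j <;> first | rfl | (exfalso; simp_all)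

/-- **`LaplaceOptimal 4` is border-false.**  For every `ε ≠ 0` the perturbed pattern `P₄ + ε·E`
(`E(v) = -K(v₀,v₂)K(v₁,v₃) + K(v₀,v₃)K(v₁,v₂)`, `K = e₁₃ + e₃₁`) is a sum of FIVE split-rank-one terms across splits of size `2`
— Laplace weight `Σ_t |S_t|!(4-|S_t|)! = 20 < 24 = 4!` — i.e. the inequality of `LaplaceOptimal 4` fails for `P₄ + εE`, while
`P₄ + εE → P₄` as `ε → 0`: the pattern `P₄` lies in the closure of the weight-`20` decompositions (first-order Grassmann–Plücker
degeneration `ε⁻¹[-A⊗A - (N-εK)⊗(N-εK) + (N+εK)⊗(N+εK)] + K⊗N + N⊗K`).  The exact statement `LaplaceOptimal 4` is untouched. -/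
theorem laplaceOptimal_four_border (ε : ℂ) (hε : ε ≠ 0) :
    ∃ (T : Finset (Fin 5)) (S : Fin 5 → Finset (Fin 4)) (u w : Fin 5 → (Fin 4 → Fin 4) → ℂ),
      (∀ t, ∀ v v' : Fin 4 → Fin 4, (∀ i ∈ S t, v i = v' i) → u t v = u t v') ∧
      (∀ t, ∀ v v' : Fin 4 → Fin 4, (∀ i, i ∉ S t → v i = v' i) → w t v = w t v') ∧
      (∑ t ∈ T, (S t).card.factorial * (4 - (S t).card).factorial) = 20 ∧ 20 < Nat.factorial 4 ∧
      ∀ v : Fin 4 → Fin 4, (∑ t ∈ T, u t v * w t v) =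
        (if Function.Injective v then 1 else 0) +
          ε * (-((if (v 0 = 1 ∧ v 2 = 3) ∨ (v 0 = 3 ∧ v 2 = 1) then (1 : ℂ) else 0) *
                  (if (v 1 = 1 ∧ v 3 = 3) ∨ (v 1 = 3 ∧ v 3 = 1) then (1 : ℂ) else 0)) +
                (if (v 0 = 1 ∧ v 3 = 3) ∨ (v 0 = 3 ∧ v 3 = 1) then (1 : ℂ) else 0) *
                  (if (v 1 = 1 ∧ v 2 = 3) ∨ (v 1 = 3 ∧ v 2 = 1) then (1 : ℂ) else 0)) := by
  classical
  -- the letter-pair functions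
  let A : Fin 4 → Fin 4 → ℂ := fun x y => if x = 0 ∧ y = 2 then 1 else if x = 2 ∧ y = 0 then -1 else 0
  let N : Fin 4 → Fin 4 → ℂ := fun x y => if (x = 0 ∧ y = 2) ∨ (x = 2 ∧ y = 0) then 1 else 0
  let K : Fin 4 → Fin 4 → ℂ := fun x y => if (x = 1 ∧ y = 3) ∨ (x = 3 ∧ y = 1) then 1 else 0
  -- the five terms: splits {0,1}, {0,2}, {0,3}, {0,1}, {0,1}
  let S : Fin 5 → Finset (Fin 4) := ![{0, 1}, {0, 2}, {0, 3}, {0, 1}, {0, 1}]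
  let u : Fin 5 → (Fin 4 → Fin 4) → ℂ := ![fun v => -ε⁻¹ * A (v 0) (v 1),
    fun v => -ε⁻¹ * (N (v 0) (v 2) - ε * K (v 0) (v 2)), fun v => ε⁻¹ * (N (v 0) (v 3) + ε * K (v 0) (v 3)),
    fun v => K (v 0) (v 1), fun v => N (v 0) (v 1)]
  let w : Fin 5 → (Fin 4 → Fin 4) → ℂ := ![fun v => A (v 2) (v 3), fun v => N (v 1) (v 3) - ε * K (v 1) (v 3),
    fun v => N (v 1) (v 2) + ε * K (v 1) (v 2), fun v => N (v 2) (v 3), fun v => K (v 2) (v 3)]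
  refine ⟨Finset.univ, S, u, w, ?_, ?_, by decide, by decide, ?_⟩
  · -- `u t` only sees `v|_{S t}`
    intro t v v' h
    fin_cases t
    · have h0 := h 0 (by simp [S]); have h1 := h 1 (by simp [S]); simp [u, h0, h1]
    · have h0 := h 0 (by simp [S]); have h1 := h 2 (by simp [S]); simp [u, h0, h1]
    · have h0 := h 0 (by simp [S]); have h1 := h 3 (by simp [S]); simp [u, h0, h1]
    · have h0 := h 0 (by simp [S]); have h1 := h 1 (by simp [S]); simp [u, h0, h1]
    · have h0 := h 0 (by simp [S]); have h1 := h 1 (by simp [S]); simp [u, h0, h1]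
  · -- `w t` only sees `v` off `S t`
    intro t v v' h
    fin_cases t
    · have h0 := h 2 (by simp [S]); have h1 := h 3 (by simp [S]); simp [w, h0, h1]
    · have h0 := h 1 (by simp [S]); have h1 := h 3 (by simp [S]); simp [w, h0, h1]
    · have h0 := h 1 (by simp [S]); have h1 := h 2 (by simp [S]); simp [w, h0, h1]
    · have h0 := h 2 (by simp [S]); have h1 := h 3 (by simp [S]); simp [w, h0, h1]
    · have h0 := h 2 (by simp [S]); have h1 := h 3 (by simp [S]); simp [w, h0, h1]
  · -- the identity
    intro v
    have h0 := plucker_coeff_zero (v 0) (v 1) (v 2) (v 3)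
    have h1 := laplace_coeff_one (v 0) (v 1) (v 2) (v 3)
    have h0' : -(A (v 0) (v 1) * A (v 2) (v 3)) - N (v 0) (v 2) * N (v 1) (v 3) + N (v 0) (v 3) * N (v 1) (v 2) = 0 := by
      have := congrArg (Int.cast : ℤ → ℂ) h0
      push_cast at this
      simpa [A, N, apply_ite (Int.cast : ℤ → ℂ)] using this
    have h1' : N (v 0) (v 2) * K (v 1) (v 3) + K (v 0) (v 2) * N (v 1) (v 3) + N (v 0) (v 3) * K (v 1) (v 2) +
        K (v 0) (v 3) * N (v 1) (v 2) + K (v 0) (v 1) * N (v 2) (v 3) + N (v 0) (v 1) * K (v 2) (v 3) =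
        if Function.Injective v then 1 else 0 := by
      have := congrArg (Int.cast : ℤ → ℂ) h1
      push_cast at this
      by_cases hv : Function.Injective v
      · rw [if_pos hv]
        rw [if_pos ((injective_iff_pairwise v).1 hv)] at this
        simpa [N, K, apply_ite (Int.cast : ℤ → ℂ)] using this
      · rw [if_neg hv]
        rw [if_neg (mt (injective_iff_pairwise v).2 hv)] at this
        simpa [N, K, apply_ite (Int.cast : ℤ → ℂ)] using this
    rw [Fin.sum_univ_five]
    show u 0 v * w 0 v + u 1 v * w 1 v + u 2 v * w 2 v + u 3 v * w 3 v + u 4 v * w 4 v = _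
    simp only [u, w, Matrix.cons_val_zero, Matrix.cons_val_one, Matrix.head_cons, Matrix.cons_val_two,
      Matrix.tail_cons, Matrix.cons_val_three, Matrix.cons_val_four]
    rw [← h1']
    have key : -ε⁻¹ * A (v 0) (v 1) * A (v 2) (v 3) +
        -ε⁻¹ * (N (v 0) (v 2) - ε * K (v 0) (v 2)) * (N (v 1) (v 3) - ε * K (v 1) (v 3)) +
        ε⁻¹ * (N (v 0) (v 3) + ε * K (v 0) (v 3)) * (N (v 1) (v 2) + ε * K (v 1) (v 2)) =
        ε⁻¹ * (-(A (v 0) (v 1) * A (v 2) (v 3)) - N (v 0) (v 2) * N (v 1) (v 3) + N (v 0) (v 3) * N (v 1) (v 2)) +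
        (N (v 0) (v 2) * K (v 1) (v 3) + K (v 0) (v 2) * N (v 1) (v 3) + N (v 0) (v 3) * K (v 1) (v 2) +
          K (v 0) (v 3) * N (v 1) (v 2)) * (ε⁻¹ * ε) +
        ε * (-(K (v 0) (v 2) * K (v 1) (v 3)) + K (v 0) (v 3) * K (v 1) (v 2)) * (ε⁻¹ * ε) := by
      ring
    rw [key, h0', inv_mul_cancel₀ hε]
    ring

end LaplaceFourBorder

end Summit.ValiantsHypothesis.ValiantsHypothesis.Theorems.RigidityForcesSymmetryRankRigidMinimalRepr
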